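import Summits.Schanuel.Schanuel.Theorems.ZilberEacRealSplitCore
import HarnessLib

/-!
# Totally real hyperplane × graph curve: the analytic core with prescribed lattice shifts

Zilber's Exponential-Algebraic Closedness, case ladder (host summit Schanuel, cell `pub-schanuel`,
seat 2, gen 7).  A refinement of `ZilberEacRealSplitCore.realSplit_core` needed for ZARISKI DENSITY
of the exponential points of `W = {x_{s+1} = Σⱼ rⱼ xⱼ + c, yⱼ = qⱼ(y_{s+1})}` (file
`ZilberEacRealSplitDensity`): the exponential points produced by the open-mapping engine can be
chosen with ARBITRARY prescribed lattice shifts `2πi κⱼ` in the coordinates `xⱼ`, `j ≠ j₀`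
(only `Σⱼ rⱼ kⱼ mod ℤ` matters, and `k_{j₀}` alone already reaches every target by Kronecker);
moreover the statement exports the local logarithm branches `Λⱼ` so that the LIMITS of the
coordinates `xⱼ` (`j ≠ j₀`) along the sequences are known: `Λⱼ(α) + 2πi κⱼ`.

**HONEST FRAMING.** Existence for `L × W` is in print (Gallinaro 2023 Thm 8.8); the method and the
density application are new.  Nothing here bears on Schanuel's conjecture; `ECCell 3 2` OPEN.
-/

noncomputable section

open MvPolynomial Filter Topology Complex Metric
open Literature.NumberTheory.Transcendental Literature.ModelTheory.Zilber
  Literature.ModelTheory.ExponentialFields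

set_option linter.dupNamespace false

namespace Summit.Schanuel.Schanuel.Theorems

section SplitCoreShift

variable {s : ℕ}

/-- **The analytic core with prescribed shifts.** Let `r : Fin s → ℝ` with `r j₀` irrational,
`c ∈ ℂ`, `qⱼ ∈ ℂ[u]` with `Σⱼ rⱼ deg qⱼ ≠ 1`, and `u₀ ≠ 0` a point with all `qⱼ(u₀) ≠ 0` on the level
set `log |u₀| = Σⱼ rⱼ log |qⱼ(u₀)| + Re c`.  Then there is an INFINITE set `A ⊆ ℂ` of fibre values each
of which is the limit of the last fibre coordinates `w_k` of exponential points of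
`{x_{s+1} = Σⱼ rⱼ xⱼ + c, yⱼ = qⱼ(y_{s+1})}` — `e^{xⱼ} = qⱼ(w)`, `e^{Σ rⱼ xⱼ + c} = w` — whose
`j₀`-th coordinate tends to infinity, whose other coordinates converge to `Λⱼ(α) + 2πi κⱼ` for
PRESCRIBED `κ ∈ ℤˢ`, `Λⱼ` a local branch of `log qⱼ` independent of `κ`. -/
theorem realSplit_core_shift (r : Fin s → ℝ) {j₀ : Fin s} (hj₀ : Irrational (r j₀)) (c : ℂ)
    {q : Fin s → Polynomial ℂ} (hdeg : ∑ j, r j * ((q j).natDegree : ℝ) ≠ 1) {u₀ : ℂ}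
    (hu₀ : u₀ ≠ 0) (hq₀ : ∀ j, (q j).eval u₀ ≠ 0)
    (hlev : Real.log ‖u₀‖ = ∑ j, r j * Real.log ‖(q j).eval u₀‖ + c.re) :
    ∃ (A : Set ℂ) (Λ : Fin s → ℂ → ℂ), A.Infinite ∧ ∀ α ∈ A, ∀ κ : Fin s → ℤ,
      ∃ (x : ℕ → Fin s → ℂ) (w : ℕ → ℂ),
      Tendsto (fun k => ‖x k j₀‖) atTop atTop ∧ Tendsto w atTop (𝓝 α) ∧
      (∀ j, j ≠ j₀ → Tendsto (fun k => x k j) atTop (𝓝 (Λ j α + (κ j : ℂ) * (2 * Real.pi * I)))) ∧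
      ∀ k, (∀ j, exp (x k j) = (q j).eval (w k)) ∧ exp (∑ j, (r j : ℂ) * x k j + c) = w k := by
  classical
  have hq : ∀ j, q j ≠ 0 := by
    intro j h0
    exact hq₀ j (by rw [h0, Polynomial.eval_zero])
  -- Step 0: a ball around `u₀` on which all local logarithms are holomorphic
  obtain ⟨r₀, hr₀, hrD⟩ : ∃ r₀ > 0, ∀ u ∈ ball u₀ r₀,
      u / u₀ ∈ slitPlane ∧ ∀ j, (q j).eval u / (q j).eval u₀ ∈ slitPlane := by
    have h1 : ∀ᶠ u in 𝓝 u₀, u / u₀ ∈ slitPlane := by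
      have hc : ContinuousAt (fun u : ℂ => u / u₀) u₀ := (continuous_id.div_const u₀).continuousAt
      refine hc.eventually_mem (isOpen_slitPlane.mem_nhds ?_)
      rw [div_self hu₀]
      exact one_mem_slitPlane
    have h2 : ∀ j, ∀ᶠ u in 𝓝 u₀, (q j).eval u / (q j).eval u₀ ∈ slitPlane := by
      intro j
      have hc : ContinuousAt (fun u : ℂ => (q j).eval u / (q j).eval u₀) u₀ :=
        ((q j).continuous.div_const _).continuousAt
      refine hc.eventually_mem (isOpen_slitPlane.mem_nhds ?_)
      rw [div_self (hq₀ j)]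
      exact one_mem_slitPlane
    exact Metric.eventually_nhds_iff_ball.1 (h1.and (eventually_all.2 h2))
  have hD0 : ∀ u ∈ ball u₀ r₀, u ≠ 0 := fun u hu h0 =>
    slitPlane_ne_zero (hrD u hu).1 (by rw [h0, zero_div])
  have hDq : ∀ u ∈ ball u₀ r₀, ∀ j, (q j).eval u ≠ 0 := fun u hu j h0 =>
    slitPlane_ne_zero ((hrD u hu).2 j) (by rw [h0, zero_div])
  -- the local logarithms and `L`
  set ℓ₀ : ℂ → ℂ := fun u => log (u / u₀) + log u₀ with hℓ₀
  set ℓ : Fin s → ℂ → ℂ := fun j u => log ((q j).eval u / (q j).eval u₀) + log ((q j).eval u₀)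
    with hℓ
  set L : ℂ → ℂ := fun u => ℓ₀ u - ∑ j, (r j : ℂ) * ℓ j u - c with hL
  have hexp₀ : ∀ u ∈ ball u₀ r₀, exp (ℓ₀ u) = u := by
    intro u hu
    rw [hℓ₀, exp_add, exp_log (div_ne_zero (hD0 u hu) hu₀), exp_log hu₀, div_mul_cancel₀ _ hu₀]
  have hexp : ∀ u ∈ ball u₀ r₀, ∀ j, exp (ℓ j u) = (q j).eval u := by
    intro u hu j
    simp only [hℓ]
    rw [exp_add, exp_log (div_ne_zero (hDq u hu j) (hq₀ j)), exp_log (hq₀ j),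
      div_mul_cancel₀ _ (hq₀ j)]
  -- derivatives
  have hdℓ₀ : ∀ u ∈ ball u₀ r₀, HasDerivAt ℓ₀ u⁻¹ u := by
    intro u hu
    have h1 : HasDerivAt (fun u : ℂ => u / u₀) (1 / u₀) u := (hasDerivAt_id u).div_const u₀
    have h2 := (h1.clog (hrD u hu).1).add_const (log u₀)
    refine h2.congr_deriv ?_
    field_simp [hD0 u hu, hu₀]
  have hdℓ : ∀ u ∈ ball u₀ r₀, ∀ j,
      HasDerivAt (ℓ j) ((Polynomial.derivative (q j)).eval u / (q j).eval u) u := by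
    intro u hu j
    have h1 : HasDerivAt (fun u : ℂ => (q j).eval u / (q j).eval u₀)
        ((Polynomial.derivative (q j)).eval u / (q j).eval u₀) u := ((q j).hasDerivAt u).div_const _
    have h2 := (h1.clog ((hrD u hu).2 j)).add_const (log ((q j).eval u₀))
    refine h2.congr_deriv ?_
    field_simp [hDq u hu j, hq₀ j]
  have hdL : ∀ u ∈ ball u₀ r₀, HasDerivAt L
      (u⁻¹ - ∑ j, (r j : ℂ) * ((Polynomial.derivative (q j)).eval u / (q j).eval u)) u := by
    intro u hu
    have hs : HasDerivAt (fun u => ∑ j, (r j : ℂ) * ℓ j u)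
        (∑ j, (r j : ℂ) * ((Polynomial.derivative (q j)).eval u / (q j).eval u)) u :=
      HasDerivAt.fun_sum fun j _ => (hdℓ u hu j).const_mul (r j : ℂ)
    exact ((hdℓ₀ u hu).sub hs).sub_const c
  have hdiff : DifferentiableOn ℂ L (ball u₀ r₀) := fun u hu =>
    (hdL u hu).differentiableAt.differentiableWithinAt
  -- Step 1: local surjectivity of `L` near every point of the ball (open mapping theorem)
  have hsurj : ∀ u₁ ∈ ball u₀ r₀, ∀ ρ > (0 : ℝ), ∃ δ > (0 : ℝ), ∀ c' : ℂ, ‖c' - L u₁‖ < δ →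
      ∃ u ∈ ball u₁ ρ, L u = c' := by
    intro u₁ hu₁ ρ hρ
    have han : AnalyticAt ℂ L u₁ := hdiff.analyticAt (isOpen_ball.mem_nhds hu₁)
    rcases han.eventually_constant_or_nhds_le_map_nhds with hconst | hmap
    · -- `L` locally constant: then `1/u = Σ rⱼ qⱼ'/qⱼ` near `u₁`, so `Σ rⱼ deg qⱼ = 1`
      exfalso
      obtain ⟨ρ', hρ', hball⟩ := Metric.mem_nhds_iff.1
        (hconst.and (isOpen_ball.mem_nhds hu₁ : ball u₀ r₀ ∈ 𝓝 u₁))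
      refine hdeg (sum_mul_natDegree_eq_one_of_prod_eq r hq ?_)
      refine Polynomial.eq_of_infinite_eval_eq _ _
        ((infinite_of_mem_nhds u₁ (ball_mem_nhds u₁ hρ')).mono fun u hu => ?_)
      have huD : u ∈ ball u₀ r₀ := (hball hu).2
      have hev : L =ᶠ[𝓝 u] fun _ => L u₁ :=
        Filter.eventually_of_mem (isOpen_ball.mem_nhds hu) fun v hv => (hball hv).1
      have hd0 : deriv L u = 0 := by rw [hev.deriv_eq, deriv_const]
      rw [(hdL u huD).deriv] at hd0
      have hu0 := hD0 u huD
      have hqu := hDq u huD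
      -- evaluate both sides
      simp only [Set.mem_setOf_eq, Polynomial.eval_prod, Polynomial.eval_mul, Polynomial.eval_X,
        Polynomial.eval_finsetSum, Polynomial.eval_C]
      have hprod : ∀ j, (q j).eval u * ∏ i ∈ Finset.univ.erase j, (q i).eval u =
          ∏ i, (q i).eval u := fun j =>
        Finset.mul_prod_erase Finset.univ (fun i => (q i).eval u) (Finset.mem_univ j)
      have hP0 : ∏ i, (q i).eval u ≠ 0 := Finset.prod_ne_zero_iff.2 fun i _ => hqu i
      -- `Σ rⱼ qⱼ' ∏_{i≠j} qᵢ = (∏ qᵢ) · Σ rⱼ qⱼ'/qⱼ`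
      have hsum : ∑ j, (r j : ℂ) * ((Polynomial.derivative (q j)).eval u *
          ∏ i ∈ Finset.univ.erase j, (q i).eval u) =
          (∏ i, (q i).eval u) * ∑ j, (r j : ℂ) * ((Polynomial.derivative (q j)).eval u /
            (q j).eval u) := by
        rw [Finset.mul_sum]
        refine Finset.sum_congr rfl fun j _ => ?_
        rw [← hprod j]
        field_simp [hqu j]
      rw [hsum]
      have h5 : ∑ j, (r j : ℂ) * ((Polynomial.derivative (q j)).eval u / (q j).eval u) = u⁻¹ := by
        linear_combination -hd0
      rw [h5]
      field_simp
    · have hmem : L '' ball u₁ ρ ∈ 𝓝 (L u₁) := hmap (image_mem_map (ball_mem_nhds u₁ hρ))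
      obtain ⟨δ, hδ, hsub⟩ := Metric.mem_nhds_iff.1 hmem
      refine ⟨δ, hδ, fun c' hc' => ?_⟩
      obtain ⟨u, hu, huc⟩ := hsub (mem_ball_iff_norm.2 hc')
      exact ⟨u, hu, huc⟩
  -- Step 2: `L u₀` is purely imaginary
  have hLre : (L u₀).re = 0 := by
    have h1 : L u₀ = log u₀ - ∑ j, (r j : ℂ) * log ((q j).eval u₀) - c := by
      simp only [hL, hℓ₀, hℓ, div_self hu₀, div_self (hq₀ _), Complex.log_one, zero_add]
    rw [h1, sub_re, sub_re, re_sum, log_re, hlev]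
    simp only [re_ofReal_mul, log_re]
    ring
  -- Step 3: the infinite set of accumulation values
  set A : Set ℂ := {u | u ∈ ball u₀ (r₀ / 2) ∧ (L u).re = 0} with hA
  have hr2 : 0 < r₀ / 2 := half_pos hr₀
  have hAD : ∀ u ∈ A, u ∈ ball u₀ r₀ := fun u hu =>
    mem_ball.2 ((mem_ball.1 hu.1).trans (half_lt_self hr₀))
  refine ⟨A, ℓ, ?_, fun α hα κ => ?_⟩
  · obtain ⟨δ, hδ, hδs⟩ := hsurj u₀ (mem_ball_self hr₀) (r₀ / 2) hr2
    obtain ⟨T, hT⟩ : ∃ T : ℝ, L u₀ = (T : ℂ) * I :=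
      ⟨(L u₀).im, by
        conv_lhs => rw [← re_add_im (L u₀), hLre]
        push_cast
        ring⟩
    have key : ∀ t : Set.Ioo (T - δ) (T + δ), ∃ u ∈ ball u₀ (r₀ / 2), L u = (t : ℝ) * I := by
      intro t
      refine hδs _ ?_
      have h1 : ((t : ℝ) : ℂ) * I - L u₀ = (((t : ℝ) - T : ℝ) : ℂ) * I := by
        rw [hT]
        push_cast
        ring
      rw [h1, norm_mul, norm_I, mul_one, norm_real, Real.norm_eq_abs, abs_lt]
      have := t.2
      constructor <;> linarith [this.1, this.2]
    choose f hf hfL using key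
    haveI : Infinite (Set.Ioo (T - δ) (T + δ)) := Set.Ioo.infinite (by linarith)
    refine Set.infinite_of_injective_forall_mem (f := f) (fun t₁ t₂ h12 => ?_) fun t => ⟨hf t, ?_⟩
    · have h1 := hfL t₁
      rw [h12, hfL t₂] at h1
      have h2 := mul_right_cancel₀ I_ne_zero h1
      exact Subtype.ext (by exact_mod_cast h2.symm)
    · rw [hfL t, mul_I_re, ofReal_im, neg_zero]
  · -- Step 4: sequences of exponential points accumulating at `α`
    have hαD : α ∈ ball u₀ r₀ := hAD α hα
    have hLα : L α = ((L α).im : ℂ) * I := by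
      conv_lhs => rw [← re_add_im (L α), hα.2]
      push_cast
      ring
    -- the contribution of the prescribed shifts
    set S : ℝ := ∑ j ∈ Finset.univ.erase j₀, r j * (κ j : ℝ) with hS
    have key : ∀ n : ℕ, ∃ u : ℂ, ∃ k m : ℤ, u ∈ ball α (min (r₀ / 2) (1 / ((n : ℝ) + 1))) ∧
        (n : ℤ) < |k| ∧
        L u = ((m : ℂ) + (r j₀ : ℂ) * (k : ℂ) + (S : ℂ)) * (2 * Real.pi * I) := by
      intro n
      obtain ⟨δ, hδ, hδs⟩ := hsurj α hαD (min (r₀ / 2) (1 / ((n : ℝ) + 1)))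
        (lt_min hr2 (by positivity))
      obtain ⟨k, m, hk, hkm⟩ := exists_int_int_near_of_irrational hj₀
        ((L α).im / (2 * Real.pi) - S) (div_pos hδ Real.two_pi_pos) n
      obtain ⟨u, hu, huL⟩ := hδs (((m : ℂ) + (r j₀ : ℂ) * (k : ℂ) + (S : ℂ)) * (2 * Real.pi * I)) (by
        rw [hLα]
        have h1 : ((m : ℂ) + (r j₀ : ℂ) * (k : ℂ) + (S : ℂ)) * (2 * Real.pi * I) -
            ((L α).im : ℂ) * I =
            ((((m : ℝ) + r j₀ * k + S) * (2 * Real.pi) - (L α).im : ℝ) : ℂ) * I := by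
          push_cast
          ring
        have h2 : ((m : ℝ) + r j₀ * k + S) * (2 * Real.pi) - (L α).im =
            ((m : ℝ) + r j₀ * k - ((L α).im / (2 * Real.pi) - S)) * (2 * Real.pi) := by
          rw [sub_mul, sub_mul, div_mul_cancel₀ _ (ne_of_gt Real.two_pi_pos)]
          ring
        rw [h1, norm_mul, norm_I, mul_one, norm_real, Real.norm_eq_abs, h2, abs_mul,
          abs_of_pos Real.two_pi_pos]
        exact (lt_div_iff₀ Real.two_pi_pos).1 hkm)
      exact ⟨u, k, m, hu, hk, huL⟩
    choose u k m hu hk hLu using key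
    have huD : ∀ n, u n ∈ ball u₀ r₀ := by
      intro n
      have h1 : dist (u n) α < r₀ / 2 := (mem_ball.1 (hu n)).trans_le (min_le_left _ _)
      have h2 : dist α u₀ < r₀ / 2 := mem_ball.1 hα.1
      exact mem_ball.2 (by linarith [dist_triangle (u n) α u₀])
    -- the exponential points: `xⱼ = ℓⱼ(u) + 2πi (k [j = j₀] or κⱼ [j ≠ j₀])`
    set x : ℕ → Fin s → ℂ := fun n j =>
      ℓ j (u n) + (if j = j₀ then (k n : ℂ) else (κ j : ℂ)) * (2 * Real.pi * I) with hx
    have hw : Tendsto u atTop (𝓝 α) := by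
      rw [Metric.tendsto_atTop]
      intro ε hε
      obtain ⟨N, hN⟩ := exists_nat_one_div_lt hε
      refine ⟨N, fun n hn => ?_⟩
      have h1 : dist (u n) α < 1 / ((n : ℝ) + 1) :=
        (mem_ball.1 (hu n)).trans_le (min_le_right _ _)
      refine h1.trans_le ((one_div_le_one_div_of_le (by positivity) ?_).trans hN.le)
      exact_mod_cast Nat.succ_le_succ hn
    refine ⟨x, u, ?_, hw, fun j hj => ?_, fun n => ⟨fun j => ?_, ?_⟩⟩
    · -- `|x_n j₀| → ∞`
      have hxj₀ : ∀ n, x n j₀ = ℓ j₀ (u n) + (k n : ℂ) * (2 * Real.pi * I) := fun n => by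
        simp [hx]
      have hcont : ContinuousAt (ℓ j₀) α := (hdℓ α hαD j₀).continuousAt
      have hlim : Tendsto (fun n => ℓ j₀ (u n)) atTop (𝓝 (ℓ j₀ α)) := hcont.tendsto.comp hw
      obtain ⟨B, hB⟩ := isBounded_iff_forall_norm_le.1 (isBounded_range_of_tendsto _ hlim)
      have hlow : ∀ n : ℕ, 2 * Real.pi * ((n : ℝ) + 1) - B ≤ ‖x n j₀‖ := by
        intro n
        rw [hxj₀]
        have h1 : ‖(k n : ℂ) * (2 * Real.pi * I)‖ = 2 * Real.pi * |(k n : ℝ)| := by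
          rw [norm_mul, norm_intCast]
          simp [abs_of_pos Real.pi_pos]
          ring
        have h2 : ((n : ℝ) + 1) ≤ |(k n : ℝ)| := by
          have := hk n
          rw [← Int.cast_abs]
          exact_mod_cast this
        have h3 : ‖(k n : ℂ) * (2 * Real.pi * I)‖ ≤
            ‖ℓ j₀ (u n) + (k n : ℂ) * (2 * Real.pi * I)‖ + ‖ℓ j₀ (u n)‖ := by
          have := norm_sub_le (ℓ j₀ (u n) + (k n : ℂ) * (2 * Real.pi * I)) (ℓ j₀ (u n))
          rwa [add_sub_cancel_left] at this
        have h4 : ‖ℓ j₀ (u n)‖ ≤ B := hB _ ⟨n, rfl⟩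
        nlinarith [Real.pi_pos, h1, h2, h3, h4]
      refine tendsto_atTop_mono hlow ?_
      refine tendsto_atTop_add_const_right _ (-B) ?_
      exact (tendsto_natCast_atTop_atTop.atTop_add tendsto_const_nhds).const_mul_atTop
        Real.two_pi_pos
    · -- `x_n j → Λⱼ(α) + 2πi κⱼ` for `j ≠ j₀`
      have hxj : ∀ n, x n j = ℓ j (u n) + (κ j : ℂ) * (2 * Real.pi * I) := fun n => by
        simp [hx, hj]
      have hcont : ContinuousAt (ℓ j) α := (hdℓ α hαD j).continuousAt
      have hlim : Tendsto (fun n => ℓ j (u n)) atTop (𝓝 (ℓ j α)) := hcont.tendsto.comp hw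
      simp only [hxj]
      exact hlim.add_const _
    · -- `e^{xⱼ} = qⱼ(w)`
      simp only [hx]
      split_ifs
      · rw [exp_add, hexp _ (huD n) j, exp_int_mul_two_pi_mul_I, mul_one]
      · rw [exp_add, hexp _ (huD n) j, exp_int_mul_two_pi_mul_I, mul_one]
    · -- `e^{Σ rⱼ xⱼ + c} = w`
      have hsplit : ∑ j, (r j : ℂ) * ((if j = j₀ then (k n : ℂ) else (κ j : ℂ)) *
          (2 * Real.pi * I)) = ((r j₀ : ℂ) * (k n : ℂ) + (S : ℂ)) * (2 * Real.pi * I) := by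
        rw [← Finset.add_sum_erase _ _ (Finset.mem_univ j₀), if_pos rfl, hS]
        push_cast
        rw [add_mul, Finset.sum_mul]
        congr 1
        · ring
        · refine Finset.sum_congr rfl fun j hj => ?_
          rw [if_neg (Finset.ne_of_mem_erase hj)]
          ring
      have hsum : ∑ j, (r j : ℂ) * x n j =
          ∑ j, (r j : ℂ) * ℓ j (u n) + ((r j₀ : ℂ) * (k n : ℂ) + (S : ℂ)) * (2 * Real.pi * I) := by
        simp only [hx, mul_add, Finset.sum_add_distrib, hsplit]
      have h1 : ∑ j, (r j : ℂ) * x n j + c = ℓ₀ (u n) + ((-m n : ℤ) : ℂ) * (2 * Real.pi * I) := by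
        have h2 := hLu n
        simp only [hL] at h2
        rw [hsum]
        push_cast
        linear_combination (-1 : ℂ) * h2
      rw [h1, exp_add, hexp₀ _ (huD n), exp_int_mul_two_pi_mul_I, mul_one]

end SplitCoreShift

end Summit.Schanuel.Schanuel.Theorems

end
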